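import Summits.FinalStateConjecture.FinalStateConjecture.Theorems.EIHFluxBalanceInertialRecessionChargeKinematicsSingleton

/-!
# Route EIHFluxBalance — `InertialRecession`, line `old-light-leaves-the-cone`: charge kinematics,
# XII (the pair window law)

Helper file for the crux `stmt-FinalStateConjecture-10166`
(`Summit.FinalStateConjecture.FinalStateConjecture.Theses.EIHFluxBalance.InertialRecession`), second line
lead, endgame stub `stub_expandingChargeKinematics` (S4: abstract quasi-conserved window charges with the
slack-form window law and the single-hole identification ⇒ Cesàro velocities of the painted centres).
THE ESCAPE SERIES: the endgame for `N = 3` (Case A all-pairs freezing is `ChargeKinematicsAllPairs*`;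
Case B, the escape of a fast hole from a velocity-tight pair, is this series; the assembly is
`ChargeKinematicsThree`).

XII — THE PAIR WINDOW LAW (`pair_window_law`): along any `4`-Lipschitz clearance function `ψ` with
`4‖ξ_a − ξ_c‖ ≤ ψ`, `2‖ξ_a − ξ_c‖ ≤ c₂s` and the other holes beyond `ψ`, the window `(ξ_a, min(ψ/2, c₂s))`
is `1/2`-admissible with the partner inside and everybody else beyond `2R`: one constant, one threshold,
one error; the charge is the kinematic pair charge up to the error (additivity + two identifications).

Every statement is Mathlib-only real analysis over the stub's verbatim hypotheses ([folklore]); the abstract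
charge `P` is arbitrary (adversarial), constrained only by the window law and the identification.
-/

set_option linter.dupNamespace false

noncomputable section

open Filter Set Metric Real
open scoped Topology

namespace Summit.FinalStateConjecture.FinalStateConjecture.Theorems.ChargeKinematics

open Literature.Geometry.Lorentzian

/-! ## The pair window law -/

section PairWindow

open MeasureTheory intervalIntegral

variable {N : ℕ} {M : Fin N → ℝ} {ξ v : Fin N → ℝ → E3} {κ : ℝ} {P : ℝ → E3 → ℝ → Fin 4 → ℝ}

/-- **THE PAIR WINDOW LAW along a clearance function.** Fix two holes `a ≠ c` and a rate
`0 < c₂ ≤ min((κ−κ²)/2, 1)`. With ONE constant, ONE threshold and ONE error `e_w → 0`: for every late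
interval `[s₁, s₂]` and every `4`-Lipschitz function `ψ` on it such that, along the interval,
`4‖ξ_a − ξ_c‖ ≤ ψ`, `2‖ξ_a − ξ_c‖ ≤ c₂ s` and every other hole is at distance `≥ ψ` from `ξ_a`, the window
`(ξ_a(s), R(s) = min(ψ(s)/2, c₂ s))` is `1/2`-admissible (the partner inside `R/2`, the others beyond
`2R`), so its charge changes by at most `C_w∫(R⁻² + R^{-7/4}) + e_w(s₁)` (one slack), and at every time of
the interval it is the kinematic pair charge `(M_aγ_a + M_cγ_c, M_aγ_a v_a + M_cγ_c v_c)` up to `e_w(s)`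
(additivity with member spheres `min(D/3, c₂s/4)`, `D` the least pairwise distance, and the two
single-hole identifications). In the escape lemma `ψ = |⟪u, ξ_b − ξ_a⟫|` on the approach and on the
recession regime. [folklore] -/
theorem pair_window_law (hκ0 : 0 < κ) (hκ1 : κ < 1)
    (hξ : ∀ i, ContDiff ℝ ((⊤ : ℕ∞) : WithTop ℕ∞) (ξ i))
    (hcone : ∀ i, ∀ᶠ t in atTop, ‖ξ i t‖ ≤ κ ^ 2 * t)
    (hsep : ∀ i j, i ≠ j → Tendsto (fun t ↦ ‖ξ i t - ξ j t‖) atTop atTop)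
    (hk : ∃ k : ℝ, 0 ≤ k ∧ k < 1 ∧ ∀ i, ∀ᶠ t in atTop, ‖v i t‖ ≤ k)
    (hslave : ∀ i, Tendsto (fun t ↦ deriv (ξ i) t - v i t) atTop (𝓝 0))
    (hW : ∀ δ : ℝ, 0 < δ → δ < 1 → ∃ (C R₀ T : ℝ) (η : ℝ → ℝ), Tendsto η atTop (𝓝 0) ∧ ∀ (t₁ t₂ : ℝ) (c : ℝ → E3) (R : ℝ → ℝ), T ≤ t₁ → t₁ ≤ t₂ → (∀ s ∈ Set.Icc t₁ t₂, ∀ s' ∈ Set.Icc t₁ t₂, ‖c s - c s'‖ ≤ 2 * |s - s'| ∧ |R s - R s'| ≤ 2 * |s - s'|) → (∀ s ∈ Set.Icc t₁ t₂, (R₀ ≤ R s ∧ ‖c s‖ + R s ≤ (κ + κ ^ 2) / 2 * s ∧ ∀ j, ‖ξ j s - c s‖ ≤ (1 - δ) * R s ∨ (1 + δ) * R s ≤ ‖ξ j s - c s‖)) → ∀ μ : Fin 4, |P t₂ (c t₂) (R t₂) μ - P t₁ (c t₁) (R t₁) μ| ≤ C * (∫ s in t₁..t₂, ((R s) ^ 2)⁻¹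 + ((R s) ^ (7 / 4 : ℝ))⁻¹) + η t₁)
    (hI : ∃ (C R₀ T : ℝ) (ζ : ℝ → ℝ), Tendsto ζ atTop (𝓝 0) ∧ (∀ (t : ℝ) (i : Fin N) (R : ℝ), T ≤ t → R₀ ≤ R → ‖ξ i t‖ + R ≤ (κ + κ ^ 2) / 2 * t → (∀ j, j ≠ i → 3 * R ≤ ‖ξ i t - ξ j t‖) → |P t (ξ i t) R 0 - M i * (√(1 - ‖v i t‖ ^ 2))⁻¹| ≤ ζ t + C / R ∧ ∀ k : Fin 3, |P t (ξ i t) R k.succ - M i * (√(1 - ‖v i t‖ ^ 2))⁻¹ * v i t k| ≤ ζ t + C / R) ∧ (∀ (t : ℝ) (c : E3) (R : ℝ) (A : Finset (Fin N)) (ρ : Fin N → ℝ), T ≤ t → R₀ ≤ R → ‖c‖ + R ≤ (κ + κ ^ 2) / 2 * t → (∀ j ∈ A, ‖ξ j t - c‖ ≤ R / 2) → (∀ j ∉ A, 2 * R ≤ ‖ξ j t - c‖) → (∀ j ∈ A, R₀ ≤ ρ j ∧ ρ j ≤ R / 4 ∧ ∀ j', j' ≠ j → 3 * ρ j ≤ ‖ξ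 j t - ξ j' t‖) → ∀ μ : Fin 4, |P t c R μ - ∑ j ∈ A, P t (ξ j t) (ρ j) μ| ≤ C * (R⁻¹ + ∑ j ∈ A, (ρ j)⁻¹) + ζ t))
    {a c : Fin N} (hac : a ≠ c) {c₂ : ℝ} (hc₂ : 0 < c₂) (hc₂κ : c₂ ≤ (κ - κ ^ 2) / 2) (hc₂1 : c₂ ≤ 1) :
    ∃ (Cw Tw : ℝ) (ew : ℝ → ℝ), 0 ≤ Cw ∧ Tendsto ew atTop (𝓝 0) ∧ (∀ t, Tw ≤ t → 0 ≤ ew t) ∧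
      ∀ (s₁ s₂ : ℝ) (ψ : ℝ → ℝ), Tw ≤ s₁ → s₁ ≤ s₂ →
        (∀ s ∈ Set.Icc s₁ s₂, ∀ s' ∈ Set.Icc s₁ s₂, |ψ s - ψ s'| ≤ 4 * |s - s'|) →
        (∀ s ∈ Set.Icc s₁ s₂, 4 * ‖ξ a s - ξ c s‖ ≤ ψ s ∧ 2 * ‖ξ a s - ξ c s‖ ≤ c₂ * s ∧
          ∀ l, l ≠ a → l ≠ c → ψ s ≤ ‖ξ l s - ξ a s‖) →
        (∀ μ : Fin 4, |P s₂ (ξ a s₂) (min (ψ s₂ / 2) (c₂ * s₂)) μ -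
            P s₁ (ξ a s₁) (min (ψ s₁ / 2) (c₂ * s₁)) μ| ≤
          Cw * (∫ s in s₁..s₂, ((min (ψ s / 2) (c₂ * s)) ^ 2)⁻¹ +
            ((min (ψ s / 2) (c₂ * s)) ^ (7 / 4 : ℝ))⁻¹) + ew s₁) ∧
        (∀ s ∈ Set.Icc s₁ s₂,
          |P s (ξ a s) (min (ψ s / 2) (c₂ * s)) 0 -
              (M a * (√(1 - ‖v a s‖ ^ 2))⁻¹ + M c * (√(1 - ‖v c s‖ ^ 2))⁻¹)| ≤ ew s ∧
          ∀ k' : Fin 3, |P s (ξ a s) (min (ψ s / 2) (c₂ * s)) k'.succ -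
              (M a * (√(1 - ‖v a s‖ ^ 2))⁻¹ * v a s k' +
                M c * (√(1 - ‖v c s‖ ^ 2))⁻¹ * v c s k')| ≤ ew s) := by
  classical
  obtain ⟨C, R₀, T, η, hη, hlaw⟩ := hW (1 / 2) (by norm_num) (by norm_num)
  obtain ⟨C', R₀', T', ζ, hζ, -, hadd⟩ := id hI
  obtain ⟨k, hk0, hk1, hvk⟩ := id hk
  have hκκ : 0 < κ - κ ^ 2 := by nlinarith
  have hd : ∀ i, Differentiable ℝ (ξ i) := fun i ↦ (contDiff_infty_iff_deriv.mp (hξ i)).1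
  -- (1) Lipschitz thresholds, least pairwise distance `D`, member radius `ρ = min(D/3, c₂ s/4)`
  choose TLi hTLi using fun i ↦ exists_forall_norm_sub_le_two_mul (hd i) (hslave i) hk1.le (hvk i)
  haveI : Nonempty (Fin N) := ⟨a⟩
  obtain ⟨TL, hTLge, hTL0⟩ : ∃ TL : ℝ, (∀ i, TLi i ≤ TL) ∧ 0 ≤ TL :=
    ⟨Finset.univ.sup' Finset.univ_nonempty TLi ⊔ 0,
      fun i ↦ (Finset.le_sup' TLi (Finset.mem_univ i)).trans le_sup_left, le_sup_right⟩
  obtain ⟨D, hDle, hDinf, hDlip⟩ : ∃ D : ℝ → ℝ, (∀ s (i j : Fin N), i ≠ j → D s ≤ ‖ξ i s - ξ j s‖) ∧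
      Tendsto D atTop atTop ∧ (∀ s s', TL ≤ s → TL ≤ s' → |D s - D s'| ≤ 4 * |s - s'|) := by
    let S : Finset (Fin N × Fin N) := Finset.univ.filter fun p ↦ p.1 ≠ p.2
    have hmem : ∀ {i j : Fin N}, i ≠ j → (i, j) ∈ S := fun hij ↦
      Finset.mem_filter.mpr ⟨Finset.mem_univ _, hij⟩
    have hSne : S.Nonempty := ⟨(a, c), hmem hac⟩
    refine ⟨fun s ↦ S.inf' hSne fun p ↦ ‖ξ p.1 s - ξ p.2 s‖, fun s i j hij ↦ ?_, ?_, fun s s' hs hs' ↦ ?_⟩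
    · exact Finset.inf'_le (fun p : Fin N × Fin N ↦ ‖ξ p.1 s - ξ p.2 s‖) (hmem hij)
    · refine tendsto_inf'_atTop hSne fun p hp ↦ hsep p.1 p.2 ?_
      exact (Finset.mem_filter.mp hp).2
    · refine abs_inf'_sub_inf'_le hSne fun p _ ↦ ?_
      have h1 := hTLi p.1 s s' ((hTLge _).trans hs) ((hTLge _).trans hs')
      have h2 := hTLi p.2 s s' ((hTLge _).trans hs) ((hTLge _).trans hs')
      have h3 : |‖ξ p.1 s - ξ p.2 s‖ - ‖ξ p.1 s' - ξ p.2 s'‖| ≤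
          ‖(ξ p.1 s - ξ p.2 s) - (ξ p.1 s' - ξ p.2 s')‖ := abs_norm_sub_norm_le _ _
      have h4 : ‖(ξ p.1 s - ξ p.2 s) - (ξ p.1 s' - ξ p.2 s')‖ ≤
          ‖ξ p.1 s - ξ p.1 s'‖ + ‖ξ p.2 s - ξ p.2 s'‖ := by
        have : (ξ p.1 s - ξ p.2 s) - (ξ p.1 s' - ξ p.2 s') =
            (ξ p.1 s - ξ p.1 s') - (ξ p.2 s - ξ p.2 s') := by abel
        rw [this]; exact norm_sub_le _ _
      linarith
  set ρ : ℝ → ℝ := fun s ↦ min (D s / 3) (c₂ / 4 * s) with hρdef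
  have hρlip : ∀ s s', TL ≤ s → TL ≤ s' → |ρ s - ρ s'| ≤ 2 * |s - s'| := by
    intro s s' hs hs'
    refine (abs_min_sub_min_le_max _ _ _ _).trans (max_le ?_ ?_)
    · rw [← sub_div, abs_div, abs_of_pos (by norm_num : (0 : ℝ) < 3), div_le_iff₀ (by norm_num : (0 : ℝ) < 3)]
      have := hDlip s s' hs hs'
      linarith [abs_nonneg (s - s')]
    · rw [← mul_sub, abs_mul, abs_of_pos (by positivity : 0 < c₂ / 4)]
      exact mul_le_mul_of_nonneg_right (by linarith) (abs_nonneg _)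
  have hρcone : ∀ s, TL ≤ s → ρ s ≤ (κ - κ ^ 2) / 2 * s := fun s hs ↦ by
    have hs0 : 0 ≤ s := hTL0.trans hs
    exact (min_le_right _ _).trans (by nlinarith)
  have hρsep : ∀ i, ∀ s, TL ≤ s → ∀ j, j ≠ i → 3 * ρ s ≤ ‖ξ i s - ξ j s‖ := fun i s hs j hj ↦ by
    have := hDle s i j hj.symm
    have := min_le_left (D s / 3) (c₂ / 4 * s)
    linarith
  have hρinf : Tendsto ρ atTop atTop := by
    rw [Filter.tendsto_atTop]
    intro b
    filter_upwards [(hDinf.atTop_div_const (by norm_num : (0 : ℝ) < 3)).eventually_ge_atTop b,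
      (tendsto_id.const_mul_atTop (by positivity : 0 < c₂ / 4)).eventually_ge_atTop b] with s h1 h2
    exact le_min h1 h2
  -- single-hole identifications at `ρ` for `a` and `c`
  obtain ⟨-, Ta, ea, -, hea, hea0, -, hida, hρ1a⟩ :=
    singleton_law hκ0 hκ1 hξ hcone hk hslave hW hI a (R := ρ) hρlip hρcone (hρsep a) hρinf
  obtain ⟨-, Tc, ec, -, hec, hec0, -, hidc, -⟩ :=
    singleton_law hκ0 hκ1 hξ hcone hk hslave hW hI c (R := ρ) hρlip hρcone (hρsep c) hρinf
  clear hW hI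
  -- (2) the error function and the threshold
  set Rlow : ℝ → ℝ := fun s ↦ min (2 * D s) (c₂ * s) with hRlowdef
  have hRlowinf : Tendsto Rlow atTop atTop := by
    rw [Filter.tendsto_atTop]
    intro b
    filter_upwards [(hDinf.const_mul_atTop (by norm_num : (0 : ℝ) < 2)).eventually_ge_atTop b,
      (tendsto_id.const_mul_atTop hc₂).eventually_ge_atTop b] with s h1 h2
    exact le_min h1 h2
  set ew : ℝ → ℝ := fun s ↦ |η s| + (|ζ s| + |C'| * ((Rlow s)⁻¹ + 2 * (ρ s)⁻¹)) + (ea s + ec s)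
    with hewdef
  have hR₀ev : ∀ᶠ s in atTop, max (max R₀ R₀') 1 ≤ Rlow s := hRlowinf.eventually_ge_atTop _
  have hρev : ∀ᶠ s in atTop, max R₀' 1 ≤ ρ s := hρinf.eventually_ge_atTop _
  obtain ⟨Tw, hTw⟩ := eventually_atTop.mp ((hcone a).and (hR₀ev.and (hρev.and ((eventually_ge_atTop T).and
    ((eventually_ge_atTop T').and ((eventually_ge_atTop TL).and ((eventually_ge_atTop Ta).and
      ((eventually_ge_atTop Tc).and (eventually_ge_atTop (0 : ℝ))))))))))
  refine ⟨|C|, Tw, ew, abs_nonneg C, ?_, ?_, ?_⟩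
  · -- `ew → 0`
    have h1 : Tendsto (fun t ↦ |η t|) atTop (𝓝 0) := by simpa using hη.abs
    have h2 : Tendsto (fun t ↦ |ζ t|) atTop (𝓝 0) := by simpa using hζ.abs
    have h3 : Tendsto (fun t ↦ |C'| * ((Rlow t)⁻¹ + 2 * (ρ t)⁻¹)) atTop (𝓝 0) := by
      have hR := tendsto_inv_atTop_zero.comp hRlowinf
      have hρ := (tendsto_inv_atTop_zero.comp hρinf).const_mul 2
      rw [mul_zero] at hρ
      have := (hR.add hρ).const_mul |C'|
      rw [add_zero, mul_zero] at this
      exact this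
    have h4 := hea.add hec
    rw [add_zero] at h4
    have := (h1.add (h2.add h3)).add h4
    simp only [add_zero] at this
    exact this
  · -- `0 ≤ ew` after `Tw`
    intro t ht
    obtain ⟨-, hRt, hρt, -, -, -, hTat, hTct, -⟩ := hTw t ht
    have hR1 : 1 ≤ Rlow t := (le_max_right _ _).trans hRt
    have hρ1 : 1 ≤ ρ t := (le_max_right _ _).trans hρt
    have h0a := hea0 t hTat
    have h0c := hec0 t hTct
    positivity
  intro s₁ s₂ ψ hs₁ h12 hψlip hgeom
  -- facts along the interval
  have hfacts : ∀ s ∈ Set.Icc s₁ s₂, ‖ξ a s‖ ≤ κ ^ 2 * s ∧ max (max R₀ R₀') 1 ≤ Rlow s ∧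
      max R₀' 1 ≤ ρ s ∧ T ≤ s ∧ T' ≤ s ∧ TL ≤ s ∧ Ta ≤ s ∧ Tc ≤ s ∧ 0 ≤ s :=
    fun s hs ↦ hTw s (hs₁.trans hs.1)
  -- the radius `R = min(ψ/2, c₂ s)` dominates `Rlow` on the interval
  have hRge : ∀ s ∈ Set.Icc s₁ s₂, Rlow s ≤ min (ψ s / 2) (c₂ * s) := by
    intro s hs
    obtain ⟨h4, -, -⟩ := hgeom s hs
    have hDs : D s ≤ ‖ξ a s - ξ c s‖ := hDle s a c hac
    exact min_le_min (by linarith) le_rfl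
  have hR1 : ∀ s ∈ Set.Icc s₁ s₂, 1 ≤ min (ψ s / 2) (c₂ * s) := fun s hs ↦
    ((le_max_right _ _).trans (hfacts s hs).2.1).trans (hRge s hs)
  refine ⟨fun μ ↦ ?_, fun s hs ↦ ?_⟩
  · -- the law along the path `(ξ a, R)`
    obtain ⟨-, -, -, hT1, -, hTL1, -⟩ := hfacts s₁ ⟨le_rfl, h12⟩
    have key := hlaw s₁ s₂ (fun s ↦ ξ a s) (fun s ↦ min (ψ s / 2) (c₂ * s)) hT1 h12 ?_ ?_ μ
    · refine key.trans ?_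
      have hnn : 0 ≤ ∫ s in s₁..s₂, (((min (ψ s / 2) (c₂ * s)) ^ 2)⁻¹ +
          ((min (ψ s / 2) (c₂ * s)) ^ (7 / 4 : ℝ))⁻¹) := by
        apply intervalIntegral.integral_nonneg h12
        intro s hs
        have : 0 < min (ψ s / 2) (c₂ * s) := one_pos.trans_le (hR1 s hs)
        positivity
      have hC : C * (∫ s in s₁..s₂, (((min (ψ s / 2) (c₂ * s)) ^ 2)⁻¹ +
          ((min (ψ s / 2) (c₂ * s)) ^ (7 / 4 : ℝ))⁻¹)) ≤
          |C| * ∫ s in s₁..s₂, (((min (ψ s / 2) (c₂ * s)) ^ 2)⁻¹ +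
            ((min (ψ s / 2) (c₂ * s)) ^ (7 / 4 : ℝ))⁻¹) :=
        mul_le_mul_of_nonneg_right (le_abs_self C) hnn
      have hηt : η s₁ ≤ ew s₁ := by
        obtain ⟨-, hRt, hρt, -, -, -, hTat, hTct, -⟩ := hfacts s₁ ⟨le_rfl, h12⟩
        have hR1' : 1 ≤ Rlow s₁ := (le_max_right _ _).trans hRt
        have hρ1 : 1 ≤ ρ s₁ := (le_max_right _ _).trans hρt
        have h0a := hea0 s₁ hTat
        have h0c := hec0 s₁ hTct
        have : 0 ≤ |ζ s₁| + |C'| * ((Rlow s₁)⁻¹ + 2 * (ρ s₁)⁻¹) := by positivity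
        simp only [hewdef]
        linarith [le_abs_self (η s₁)]
      linarith
    · -- the path is `2`-Lipschitz
      intro s hs s' hs'
      refine ⟨hTLi a s s' ((hTLge a).trans (hTL1.trans hs.1)) ((hTLge a).trans (hTL1.trans hs'.1)), ?_⟩
      refine (abs_min_sub_min_le_max _ _ _ _).trans (max_le ?_ ?_)
      · rw [← sub_div, abs_div, abs_of_pos (by norm_num : (0 : ℝ) < 2),
          div_le_iff₀ (by norm_num : (0 : ℝ) < 2)]
        have := hψlip s hs s' hs'
        linarith [abs_nonneg (s - s')]
      · rw [← mul_sub, abs_mul, abs_of_pos hc₂]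
        exact mul_le_mul_of_nonneg_right (by linarith) (abs_nonneg _)
    · -- admissibility: threshold, cone, clearance
      intro s hs
      obtain ⟨hcone_s, hRs, -, -, -, -, -, -, hs0⟩ := hfacts s hs
      obtain ⟨h4, h2, hoth⟩ := hgeom s hs
      have hRR := hRge s hs
      refine ⟨((le_max_left _ _).trans (le_max_left _ _)).trans (hRs.trans hRR), ?_, fun j ↦ ?_⟩
      · have : min (ψ s / 2) (c₂ * s) ≤ c₂ * s := min_le_right _ _
        nlinarith
      · by_cases hja : j = a
        · left; subst hja
          rw [sub_self, norm_zero]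
          have := hR1 s hs; positivity
        · by_cases hjc : j = c
          · left; subst hjc
            rw [norm_sub_rev]
            -- `‖ξ a - ξ c‖ ≤ R/2` from `4 d ≤ ψ` and `2 d ≤ c₂ s`
            have hle1 : ‖ξ a s - ξ j s‖ ≤ ψ s / 4 := by linarith
            have hle2 : ‖ξ a s - ξ j s‖ ≤ c₂ * s / 2 := by linarith
            have : ‖ξ a s - ξ j s‖ ≤ min (ψ s / 2) (c₂ * s) / 2 := by
              rw [le_div_iff₀ (by norm_num : (0 : ℝ) < 2)]
              exact le_min (by linarith) (by linarith)
            linarith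
          · right
            have h3 := hoth j hja hjc
            have : min (ψ s / 2) (c₂ * s) ≤ ψ s / 2 := min_le_left _ _
            linarith [norm_nonneg (ξ a s - ξ c s)]
  · -- identification at `s`: additivity over `{a, c}` with member spheres `ρ s`, plus the two singles
    obtain ⟨hcone_s, hRs, hρs, -, hT's, hTLs, hTas, hTcs, hs0⟩ := hfacts s hs
    obtain ⟨h4, h2, hoth⟩ := hgeom s hs
    have hRR := hRge s hs
    have hR1s := hR1 s hs
    have hRpos : 0 < min (ψ s / 2) (c₂ * s) := one_pos.trans_le hR1s
    have hρ1 : 1 ≤ ρ s := (le_max_right _ _).trans hρs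
    have hρpos : 0 < ρ s := one_pos.trans_le hρ1
    have hadd' := hadd s (ξ a s) (min (ψ s / 2) (c₂ * s)) {a, c} (fun _ ↦ ρ s) hT's
      (((le_max_right _ _).trans (le_max_left _ _)).trans (hRs.trans hRR))
      (by have : min (ψ s / 2) (c₂ * s) ≤ c₂ * s := min_le_right _ _; nlinarith) ?_ ?_ ?_
    rotate_left
    · -- members within `R/2`
      intro j hj
      rw [Finset.mem_insert, Finset.mem_singleton] at hj
      rcases hj with rfl | rfl
      · rw [sub_self, norm_zero]; positivity
      · rw [norm_sub_rev]
        have : ‖ξ a s - ξ j s‖ ≤ min (ψ s / 2) (c₂ * s) / 2 := by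
          rw [le_div_iff₀ (by norm_num : (0 : ℝ) < 2)]
          exact le_min (by linarith) (by linarith)
        exact this
    · -- non-members beyond `2R`
      intro j hj
      rw [Finset.mem_insert, Finset.mem_singleton, not_or] at hj
      have h3 := hoth j hj.1 hj.2
      have : min (ψ s / 2) (c₂ * s) ≤ ψ s / 2 := min_le_left _ _
      linarith
    · -- member spheres
      intro j hj
      refine ⟨(le_max_left _ _).trans hρs, ?_, fun j' hj' ↦ ?_⟩
      · -- `ρ ≤ R/4`: `D/3 ≤ ψ/8` (as `ψ ≥ 4 d_ac ≥ 4D`) and `c₂ s/4 ≤ c₂ s/4`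
        have hDs : D s ≤ ‖ξ a s - ξ c s‖ := hDle s a c hac
        change min (D s / 3) (c₂ / 4 * s) ≤ min (ψ s / 2) (c₂ * s) / 4
        rw [le_div_iff₀ (by norm_num : (0 : ℝ) < 4)]
        refine le_min ?_ ?_
        · have := min_le_left (D s / 3) (c₂ / 4 * s); linarith
        · have := min_le_right (D s / 3) (c₂ / 4 * s); linarith
      · exact hρsep j s hTLs j' hj'
    -- combine with the single-hole identifications
    have hsum : ∀ μ : Fin 4, ∑ j ∈ ({a, c} : Finset (Fin N)), P s (ξ j s) (ρ s) μ =
        P s (ξ a s) (ρ s) μ + P s (ξ c s) (ρ s) μ := fun μ ↦ Finset.sum_pair hac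
    have hcard : ∑ j ∈ ({a, c} : Finset (Fin N)), (ρ s)⁻¹ = 2 * (ρ s)⁻¹ := by
      rw [Finset.sum_pair hac]; ring
    have herrle : C' * ((min (ψ s / 2) (c₂ * s))⁻¹ + 2 * (ρ s)⁻¹) + ζ s ≤
        |ζ s| + |C'| * ((Rlow s)⁻¹ + 2 * (ρ s)⁻¹) := by
      have hRlowpos : 0 < Rlow s := one_pos.trans_le ((le_max_right _ _).trans hRs)
      have h1 : (min (ψ s / 2) (c₂ * s))⁻¹ ≤ (Rlow s)⁻¹ := inv_anti₀ hRlowpos hRR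
      have hnn : 0 ≤ (min (ψ s / 2) (c₂ * s))⁻¹ + 2 * (ρ s)⁻¹ := by positivity
      have h2 : C' * ((min (ψ s / 2) (c₂ * s))⁻¹ + 2 * (ρ s)⁻¹) ≤
          |C'| * ((min (ψ s / 2) (c₂ * s))⁻¹ + 2 * (ρ s)⁻¹) :=
        mul_le_mul_of_nonneg_right (le_abs_self C') hnn
      have h3 : |C'| * ((min (ψ s / 2) (c₂ * s))⁻¹ + 2 * (ρ s)⁻¹) ≤
          |C'| * ((Rlow s)⁻¹ + 2 * (ρ s)⁻¹) :=
        mul_le_mul_of_nonneg_left (by linarith) (abs_nonneg C')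
      linarith [le_abs_self (ζ s)]
    have hida' := hida s hTas
    have hidc' := hidc s hTcs
    constructor
    · have h1 := hadd' 0
      rw [hsum, hcard] at h1
      have h2 := hida'.1
      have h3 := hidc'.1
      have hgoal : |P s (ξ a s) (min (ψ s / 2) (c₂ * s)) 0 -
          (M a * (√(1 - ‖v a s‖ ^ 2))⁻¹ + M c * (√(1 - ‖v c s‖ ^ 2))⁻¹)| ≤
          (C' * ((min (ψ s / 2) (c₂ * s))⁻¹ + 2 * (ρ s)⁻¹) + ζ s) + ea s + ec s := by
        rw [abs_le] at h1 h2 h3 ⊢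
        constructor <;> linarith
      refine hgoal.trans ?_
      simp only [hewdef]
      linarith [abs_nonneg (η s)]
    · intro k'
      have h1 := hadd' k'.succ
      rw [hsum, hcard] at h1
      have h2 := hida'.2 k'
      have h3 := hidc'.2 k'
      have hgoal : |P s (ξ a s) (min (ψ s / 2) (c₂ * s)) k'.succ -
          (M a * (√(1 - ‖v a s‖ ^ 2))⁻¹ * v a s k' + M c * (√(1 - ‖v c s‖ ^ 2))⁻¹ * v c s k')| ≤
          (C' * ((min (ψ s / 2) (c₂ * s))⁻¹ + 2 * (ρ s)⁻¹) + ζ s) + ea s + ec s := by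
        rw [abs_le] at h1 h2 h3 ⊢
        constructor <;> linarith
      refine hgoal.trans ?_
      simp only [hewdef]
      linarith [abs_nonneg (η s)]

end PairWindow

end Summit.FinalStateConjecture.FinalStateConjecture.Theorems.ChargeKinematics

namespace Summit.FinalStateConjecture.FinalStateConjecture.Theorems

/-- REGISTERED STUB `pair_window_law` of the crux item stmt-FinalStateConjecture-10166 (second line lead, line
`old-light-leaves-the-cone`, S4 escape series): the registered one-line signature verbatim, discharged by
`ChargeKinematics.pair_window_law`. [folklore] -/
theorem pair_window_law : open Literature.Geometry.Lorentzian Filter Topology MeasureTheory intervalIntegral in ∀ {N : ℕ} {M : Fin N → ℝ} {ξ v : Fin N → ℝ → E3} {κ : ℝ} {P : ℝ → E3 → ℝ → Fin 4 → ℝ} (hκ0 : 0 < κ) (hκ1 : κ < 1) (hξ : ∀ i, ContDiff ℝ ((⊤ : ℕ∞) : WithTop ℕ∞) (ξ i)) (hcone : ∀ i, ∀ᶠ t in atTop, ‖ξ i t‖ ≤ κ ^ 2 * t) (hsep : ∀ i j, i ≠ j → Tendsto (fun t ↦ ‖ξ i t - ξ j t‖) atTop atTop) (hk : ∃ k : ℝ,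 0 ≤ k ∧ k < 1 ∧ ∀ i, ∀ᶠ t in atTop, ‖v i t‖ ≤ k) (hslave : ∀ i, Tendsto (fun t ↦ deriv (ξ i) t - v i t) atTop (𝓝 0)) (hW : ∀ δ : ℝ, 0 < δ → δ < 1 → ∃ (C R₀ T : ℝ) (η : ℝ → ℝ), Tendsto η atTop (𝓝 0) ∧ ∀ (t₁ t₂ : ℝ) (c : ℝ → E3) (R : ℝ → ℝ), T ≤ t₁ → t₁ ≤ t₂ → (∀ s ∈ Set.Icc t₁ t₂, ∀ s' ∈ Set.Icc t₁ t₂, ‖c s - c s'‖ ≤ 2 * |s - s'| ∧ |R s - R s'| ≤ 2 * |s - s'|) → (∀ s ∈ Set.Icc t₁ t₂, (R₀ ≤ R s ∧ ‖c s‖ + R s ≤ (κ + κ ^ 2) / 2 * s ∧ ∀ j, ‖ξ j s - c s‖ ≤ (1 - δ) * R s ∨ (1 + δ) * R s ≤ ‖ξ j s - c s‖)) → ∀ μ : Fin 4, |P t₂ (c t₂) (R t₂) μ - P t₁ (c t₁) (R t₁) μ| ≤ C * (∫ s in t₁..t₂, ((R s) ^ 2)⁻¹ + ((R s) ^ (7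 / 4 : ℝ))⁻¹) + η t₁) (hI : ∃ (C R₀ T : ℝ) (ζ : ℝ → ℝ), Tendsto ζ atTop (𝓝 0) ∧ (∀ (t : ℝ) (i : Fin N) (R : ℝ), T ≤ t → R₀ ≤ R → ‖ξ i t‖ + R ≤ (κ + κ ^ 2) / 2 * t → (∀ j, j ≠ i → 3 * R ≤ ‖ξ i t - ξ j t‖) → |P t (ξ i t) R 0 - M i * (√(1 - ‖v i t‖ ^ 2))⁻¹| ≤ ζ t + C / R ∧ ∀ k : Fin 3, |P t (ξ i t) R k.succ - M i * (√(1 - ‖v i t‖ ^ 2))⁻¹ * v i t k| ≤ ζ t + C / R) ∧ (∀ (t : ℝ) (c : E3) (R : ℝ) (A : Finset (Fin N)) (ρ : Fin N → ℝ), T ≤ t → R₀ ≤ R → ‖c‖ + R ≤ (κ + κ ^ 2) / 2 * t → (∀ j ∈ A, ‖ξ j t - c‖ ≤ R / 2) → (∀ j ∉ A, 2 * R ≤ ‖ξ j t - c‖) → (∀ j ∈ A, R₀ ≤ ρ j ∧ ρ j ≤ R / 4 ∧ ∀ j', j' ≠ j → 3 * ρ j ≤ ‖ξ j t - ξ j'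 t‖) → ∀ μ : Fin 4, |P t c R μ - ∑ j ∈ A, P t (ξ j t) (ρ j) μ| ≤ C * (R⁻¹ + ∑ j ∈ A, (ρ j)⁻¹) + ζ t)) {a c : Fin N} (hac : a ≠ c) {c₂ : ℝ} (hc₂ : 0 < c₂) (hc₂κ : c₂ ≤ (κ - κ ^ 2) / 2) (hc₂1 : c₂ ≤ 1), ∃ (Cw Tw : ℝ) (ew : ℝ → ℝ), 0 ≤ Cw ∧ Tendsto ew atTop (𝓝 0) ∧ (∀ t, Tw ≤ t → 0 ≤ ew t) ∧ ∀ (s₁ s₂ : ℝ) (ψ : ℝ → ℝ), Tw ≤ s₁ → s₁ ≤ s₂ → (∀ s ∈ Set.Icc s₁ s₂, ∀ s' ∈ Set.Icc s₁ s₂, |ψ s - ψ s'| ≤ 4 * |s - s'|) → (∀ s ∈ Set.Icc s₁ s₂, 4 * ‖ξ a s - ξ c s‖ ≤ ψ s ∧ 2 * ‖ξ a s - ξ c s‖ ≤ c₂ * s ∧ ∀ l, l ≠ a → l ≠ c → ψ s ≤ ‖ξ l s - ξ a s‖) → (∀ μ : Fin 4, |P s₂ (ξ a s₂) (min (ψ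 s₂ / 2) (c₂ * s₂)) μ - P s₁ (ξ a s₁) (min (ψ s₁ / 2) (c₂ * s₁)) μ| ≤ Cw * (∫ s in s₁..s₂, ((min (ψ s / 2) (c₂ * s)) ^ 2)⁻¹ + ((min (ψ s / 2) (c₂ * s)) ^ (7 / 4 : ℝ))⁻¹) + ew s₁) ∧ (∀ s ∈ Set.Icc s₁ s₂, |P s (ξ a s) (min (ψ s / 2) (c₂ * s)) 0 - (M a * (√(1 - ‖v a s‖ ^ 2))⁻¹ + M c * (√(1 - ‖v c s‖ ^ 2))⁻¹)| ≤ ew s ∧ ∀ k' : Fin 3, |P s (ξ a s) (min (ψ s / 2) (c₂ * s)) k'.succ - (M a * (√(1 - ‖v a s‖ ^ 2))⁻¹ * v a s k' + M c * (√(1 - ‖v c s‖ ^ 2))⁻¹ * v c s k')| ≤ ew s) :=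
  @ChargeKinematics.pair_window_law

end Summit.FinalStateConjecture.FinalStateConjecture.Theorems

end
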